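/-
Copyright: derived here (Resolution Observatory cell `pub-rosobs`, carver gen 60). AI-written Lean; AI review is
weaker than expert review.  Companion file of the cell's POLYNOMIAL weighted-centre model `W(f)` (engine 1's
`W(f)` / (P)-system TOY MODEL; CARVER-NOTES-eng1-g40 **T75** = LEMMA D′ "rectifying a constant", THEOREM-F §1 (ii)).
Instrument — NOT a resolution theorem and NOT a statement about the invariant of [AbramovichTemkinWlodarczyk2024].
-/
import Literature.AlgebraicGeometry.Resolution.WeightedCentreRectification
import Literature.AlgebraicGeometry.Resolution.WeightedCentreGradedAutomorphism
import Literature.AlgebraicGeometry.Resolution.WeightedCentreInvariantDirection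
import HarnessLib

/-!
# LEMMA D′ — rectifying a constant: `Y g = 0`, `Y ε_{a₀} = c₀ ≠ 0` ⇒ `g = G(ε″)` with `p ∣` every `ε″_{a₀}`-exponent

CARVER-NOTES-eng1-g40 T75 (= T9 §2.10 LEMMA D (4)–(5) without `j*`): `k` a field of characteristic `p`, integer
weights `W : ι → ℕ` (the cell's rational weights scaled), `Y = Z` a graded `k`-derivation of `k[ε_ι]` LOWERING
weights by `w′ = W a₀ > 0` with `Z ε_{a₀} = c₀ = r ≠ 0` a CONSTANT, and `W i < p·W a₀` for every slot (the cell's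
"weights `≤ ½`, `w′ > 1/(2p)`").  This is EXACTLY the setting of the cell's LEMMA CF (2) file
`WeightedCentreRectification` (§4, `exists_graded_rectification_charP`: the truncated-exponential coordinates
`ε″_i = Σ_{n<p} (−u)^n Z^n(ε_i)/n!`, `u = ε_{a₀}/r`, form a GRADED automorphism `Λ`, identity on `ε_{a₀}` and
`mod (ε_{a₀})`, with `Z ∘ Λ = r·Λ ∘ ∂_{a₀}` and `ker Z = Λ(k[ε_{≠a₀}][ε_{a₀}^p])`).  This file supplies the three
missing glue statements of T75 and packages them:

* §1 `isWeightedHomogeneous_algEquiv_symm` — the INVERSE of a graded automorphism of `k[ε]` is graded (a graded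
  algebra map commutes with taking weighted-homogeneous components: `weightedHomogeneousComponent_algHom`), so
  `G := Λ⁻¹ g` is weighted homogeneous of the weight of `g`;
* §2 the integer-to-rational weight bridge `isWeightedHomogeneous_natCast` (the Frobenius-splitting lemmas of
  `WeightedCentreInvariantDirection` are stated for rational weights) and `mul_le_weight`;
* §3 **LEMMA D′ packaged** (`exists_rectifyConstant`): for `g` weighted homogeneous of weight `μ` with `Z g = 0`
  there is such a `Λ` with `G := Λ.symm g` homogeneous of weight `μ`, `∂_{a₀} G = 0` and `p ∣ d(a₀)` for every
  exponent vector `d` of `G` ("writing `g = G(ε″)`, every `ε″_{a₀}`-exponent of `G` is `≡ 0 mod p`"); and the two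
  (K-`p`) consequences on any such `G`: `notMem_vars_of_forall_dvd_of_lt` (`μ < p·W a₀` ⇒ `G` is FREE of `ε_{a₀}`)
  and `eq_C_mul_X_pow_add_of_pderiv_eq_zero` (`μ = p·W a₀`, positive weights ⇒ `G = c′·ε_{a₀}^p + G₀`, `G₀` free
  of `ε_{a₀}`, via `InvariantDirection.eq_sum_frobenius_add`); combined: `exists_rectifyConstant_notMem_vars`,
  `exists_rectifyConstant_frobenius`.

Honest scope.  Polynomial rings over a field, `ι` finite; the analytic content (telescoping `Z(π h) = 0`,
triangularity, bijectivity) is ALL in `WeightedCentreRectification` (carver gen 49) and is only invoked here; the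
"`n!` invertible for `n < p`" of T75 is that file's `cast_factorial_pred_ne_zero`.  Literature anchors as there:
the slice / Dixmier map [cite: VandenessenKurodaCrachiola2021, Ch. 3 §3.2 (Cor. 3.2.10)], the characteristic-`p`
slice decomposition [cite: Matsumura1987, §25 Exercise 25.5], `∂_i`-kernels in characteristic `p`
[cite: Hironaka1970AdditiveGroups, additive forms and differential operators]; graded pieces of `k[ε]`
[cite: AbramovichTemkinWlodarczyk2024, §3.4 (p. 1570)].  Statements in this generality: formalisation ours /
derived here.
-/

open MvPolynomial
open Finsupp (weight)

namespace Literature.AlgebraicGeometry.Resolution.WeightedBlowup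

noncomputable section

/-! ## §1 The inverse of a graded automorphism is graded -/

section GradedInverse

variable {K : Type*} [CommRing K] {σ : Type*}

/-- A `K`-algebra endomorphism of `K[X]` sending each `X_i` to a `w`-homogeneous polynomial of weight `w i`
preserves weighted homogeneity (derived here; `isWeightedHomogeneous_aeval` of `WeightedCentreGradedAutomorphism`
for an abstract `AlgHom`). [cite: AbramovichTemkinWlodarczyk2024, §3.4 (p. 1570)] -/
theorem isWeightedHomogeneous_algHom (w : σ → ℕ) (Λ : MvPolynomial σ K →ₐ[K] MvPolynomial σ K)
    (hΛ : ∀ i, IsWeightedHomogeneous w (Λ (X i)) (w i)) {P : MvPolynomial σ K} {m : ℕ}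
    (hP : IsWeightedHomogeneous w P m) : IsWeightedHomogeneous w (Λ P) m := by
  rw [AlgHom.congr_fun (MvPolynomial.aeval_unique Λ) P]
  exact isWeightedHomogeneous_aeval w _ hΛ hP

/-- **A graded algebra map commutes with taking weighted-homogeneous components**:
`comp_n (Λ G) = Λ (comp_n G)` (derived here). [cite: AbramovichTemkinWlodarczyk2024, §3.4 (p. 1570)] -/
theorem weightedHomogeneousComponent_algHom (w : σ → ℕ) (Λ : MvPolynomial σ K →ₐ[K] MvPolynomial σ K)
    (hΛ : ∀ i, IsWeightedHomogeneous w (Λ (X i)) (w i)) (G : MvPolynomial σ K) (n : ℕ) :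
    weightedHomogeneousComponent w n (Λ G) = Λ (weightedHomogeneousComponent w n G) := by
  classical
  have hfin := weightedHomogeneousComponent_finsupp (w := w) G
  have hG : G = ∑ m ∈ hfin.toFinset, weightedHomogeneousComponent w m G := by
    conv_lhs => rw [← sum_weightedHomogeneousComponent w G]
    exact finsum_eq_sum _ hfin
  have hhom : ∀ m, IsWeightedHomogeneous w (Λ (weightedHomogeneousComponent w m G)) m := fun m =>
    isWeightedHomogeneous_algHom w Λ hΛ (weightedHomogeneousComponent_isWeightedHomogeneous m G)
  conv_lhs => rw [hG, map_sum, map_sum]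
  rw [Finset.sum_eq_single n (fun m _ hmn => (hhom m).weightedHomogeneousComponent_ne n hmn.symm) fun hn => ?_]
  · exact (hhom n).weightedHomogeneousComponent_same
  · have h0 : weightedHomogeneousComponent w n G = 0 := by
      simpa [Set.Finite.mem_toFinset, Function.mem_support] using hn
    rw [h0, map_zero, map_zero]

/-- **The inverse of a graded automorphism is graded**: if `Λ` is a `K`-algebra automorphism of `K[X]` with
`Λ(X_i)` homogeneous of weight `w i`, then `Λ⁻¹` maps `w`-homogeneous polynomials of weight `m` to such (derived
here: for `n ≠ m`, `Λ(comp_n Λ⁻¹f) = comp_n f = 0`, and `Λ` is injective).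
[cite: AbramovichTemkinWlodarczyk2024, §3.4 (p. 1570)] -/
theorem isWeightedHomogeneous_algEquiv_symm (w : σ → ℕ) (Λ : MvPolynomial σ K ≃ₐ[K] MvPolynomial σ K)
    (hΛ : ∀ i, IsWeightedHomogeneous w (Λ (X i)) (w i)) {f : MvPolynomial σ K} {m : ℕ}
    (hf : IsWeightedHomogeneous w f m) : IsWeightedHomogeneous w (Λ.symm f) m := by
  classical
  have hcomp : ∀ n, n ≠ m → weightedHomogeneousComponent w n (Λ.symm f) = 0 := fun n hn => by
    have h := weightedHomogeneousComponent_algHom w (Λ : MvPolynomial σ K →ₐ[K] MvPolynomial σ K) hΛ (Λ.symm f) n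
    rw [AlgEquiv.coe_toAlgHom, AlgEquiv.apply_symm_apply, hf.weightedHomogeneousComponent_ne n hn] at h
    exact Λ.injective (by rw [map_zero]; exact h.symm)
  have hG : Λ.symm f = weightedHomogeneousComponent w m (Λ.symm f) := by
    conv_lhs => rw [← sum_weightedHomogeneousComponent w (Λ.symm f)]
    exact finsum_eq_single _ m fun n hn => hcomp n hn
  rw [hG]
  exact weightedHomogeneousComponent_isWeightedHomogeneous m _

end GradedInverse

/-! ## §2 Weight bookkeeping: integer vs rational weights -/

section Weights

variable {K : Type*} [CommSemiring K] {σ : Type*}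

/-- `|d|_{W} ` computed in `ℚ` is the cast of `|d|_W` (plumbing). [cite: AbramovichTemkinWlodarczyk2024, §3.4 (p. 1570)] -/
theorem weight_natCast (W : σ → ℕ) (d : σ →₀ ℕ) :
    weight (fun i => (W i : ℚ)) d = ((weight W d : ℕ) : ℚ) := by
  simp only [Finsupp.weight_apply, Finsupp.sum, smul_eq_mul, nsmul_eq_mul, Nat.cast_sum, Nat.cast_mul]

/-- Integer-weighted homogeneity implies rational-weighted homogeneity for the cast weights (plumbing; bridge to the
rational-weight lemmas of `WeightedCentreInvariantDirection`). [cite: AbramovichTemkinWlodarczyk2024, §3.4 (p. 1570)] -/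
theorem isWeightedHomogeneous_natCast {W : σ → ℕ} {P : MvPolynomial σ K} {m : ℕ}
    (h : IsWeightedHomogeneous W P m) : IsWeightedHomogeneous (fun i => (W i : ℚ)) P (m : ℚ) := fun d hd => by
  rw [weight_natCast, h hd]

/-- `d(i)·W(i) ≤ |d|_W` (plumbing). [cite: AbramovichTemkinWlodarczyk2024, §3.4 (p. 1570)] -/
theorem mul_le_weight (W : σ → ℕ) (d : σ →₀ ℕ) (i : σ) : d i * W i ≤ weight W d := by
  classical
  rw [Finsupp.weight_apply, Finsupp.sum]
  by_cases hi : i ∈ d.support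
  · have h := Finset.single_le_sum (f := fun j => d j • W j) (fun j _ => Nat.zero_le _) hi
    simpa only [smul_eq_mul] using h
  · rw [Finsupp.notMem_support_iff.mp hi, zero_mul]
    exact Nat.zero_le _

end Weights

/-! ## §3 LEMMA D′ packaged, and the (K-`p`) consequences -/

section RectifyConstant

variable {k : Type*} [Field k] {ι : Type*}

/-- **(K-`p`), free case**: if every `X_{i₀}`-exponent of a `W`-homogeneous `G` of weight `μ` is divisible by `p`
and `μ < p·W i₀`, then `G` is FREE of `X_{i₀}` (derived here: an exponent `≥ p` alone weighs `≥ p·W i₀ > μ`).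
[cite: Hironaka1970AdditiveGroups, additive forms and differential operators] -/
theorem notMem_vars_of_forall_dvd_of_lt {p : ℕ} {W : ι → ℕ} {i₀ : ι} {G : MvPolynomial ι k}
    {μ : ℕ} (hG : IsWeightedHomogeneous W G μ) (hdvd : ∀ d ∈ G.support, p ∣ d i₀) (hμ : μ < p * W i₀) :
    i₀ ∉ G.vars := by
  rw [mem_vars_iff_mem_support]
  rintro ⟨d, hd, hi⟩
  have hdi : d i₀ ≠ 0 := Finsupp.mem_support_iff.mp hi
  have hpd : p ≤ d i₀ := Nat.le_of_dvd (Nat.pos_of_ne_zero hdi) (hdvd d hd)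
  have hwt : weight W d = μ := hG (mem_support_iff.mp hd)
  have h1 := mul_le_weight W d i₀
  have h2 : p * W i₀ ≤ d i₀ * W i₀ := Nat.mul_le_mul_right _ hpd
  omega

/-- **(K-`p`), boundary case** (`μ = p·W i₀`, all weights positive): `∂_{i₀} G = 0` ⇒ `G = c′·X_{i₀}^p + G₀` with
`c′ = coeff_{p e_{i₀}} G` and `G₀` free of `X_{i₀}` (derived here from `InvariantDirection.eq_sum_frobenius_add`
with `S = {i₀}` and cast weights). [cite: Lang2002, Ch. V §6] -/
theorem eq_C_mul_X_pow_add_of_pderiv_eq_zero (p : ℕ) [Fact p.Prime] [CharP k p] [DecidableEq ι]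
    {W : ι → ℕ} (hW : ∀ j, 0 < W j) {i₀ : ι} {G : MvPolynomial ι k} {μ : ℕ}
    (hG : IsWeightedHomogeneous W G μ) (hD : pderiv i₀ G = 0) (hμ : p * W i₀ = μ) :
    i₀ ∉ (G - C (G.coeff (Finsupp.single i₀ p)) * X i₀ ^ p).vars ∧
      G = C (G.coeff (Finsupp.single i₀ p)) * X i₀ ^ p + (G - C (G.coeff (Finsupp.single i₀ p)) * X i₀ ^ p) := by
  have hw : ∀ j, (0 : ℚ) < (W j : ℚ) := fun j => by exact_mod_cast hW j
  have hS : ∀ i ∈ ({i₀} : Finset ι), (p : ℚ) * (W i : ℚ) = (μ : ℚ) := fun i hi => by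
    rw [Finset.mem_singleton.mp hi]
    exact_mod_cast hμ
  have hDS : ∀ i ∈ ({i₀} : Finset ι), pderiv i G = 0 := fun i hi => by
    rw [Finset.mem_singleton.mp hi]; exact hD
  obtain ⟨h1, h2⟩ := InvariantDirection.eq_sum_frobenius_add p hw (isWeightedHomogeneous_natCast hG) {i₀} hS hDS
  simp only [Finset.sum_singleton, Finset.mem_singleton, forall_eq] at h1 h2
  exact ⟨h1, h2⟩

variable [Fintype ι] [DecidableEq ι]

/-- **LEMMA D′ (T75), packaged.**  `Z` a graded `k`-derivation of `k[ε_ι]` lowering weights by `W i₀ > 0`, with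
`Z ε_{i₀} = r ≠ 0` a constant, characteristic `p` with `W i < p·W i₀` for all `i`; `g` weighted homogeneous of
weight `μ` with `Z g = 0`.  Then there is a GRADED automorphism `Λ` (`ε″ = Λ ε`: identity on `ε_{i₀}`, `≡ id`
`mod (ε_{i₀})`, `Z(ε″_i) = 0` for `i ≠ i₀`, `Z ∘ Λ = r·Λ ∘ ∂_{i₀}`) such that `G := Λ⁻¹ g` — i.e. `g = G(ε″)` — is
weighted homogeneous of weight `μ`, `∂_{i₀} G = 0`, and every `ε″_{i₀}`-exponent of `G` is divisible by `p`
(derived here from `exists_graded_rectification` + §1).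
[cite: VandenessenKurodaCrachiola2021, Ch. 3 §3.2 (Cor. 3.2.10)] [cite: Matsumura1987, §25 Exercise 25.5]
[cite: Hironaka1970AdditiveGroups, additive forms and differential operators] -/
theorem exists_rectifyConstant (p : ℕ) [hp : Fact p.Prime] [CharP k p]
    (Z : Derivation k (MvPolynomial ι k) (MvPolynomial ι k)) (W : ι → ℕ) (i₀ : ι) (r : k)
    (hZ : ∀ i, ∀ d ∈ (Z (X i)).support, weight W d + W i₀ = W i) (hw : 0 < W i₀) (h0 : Z (X i₀) = C r)
    (hr : r ≠ 0) (hWp : ∀ i, W i < p * W i₀) {g : MvPolynomial ι k} {μ : ℕ}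
    (hg : IsWeightedHomogeneous W g μ) (hZg : Z g = 0) :
    ∃ Λ : MvPolynomial ι k ≃ₐ[k] MvPolynomial ι k,
      Λ (X i₀) = X i₀ ∧
      (∀ i, IsWeightedHomogeneous W (Λ (X i)) (W i)) ∧
      (∀ i, Λ (X i) - X i ∈ Ideal.span ({X i₀} : Set (MvPolynomial ι k))) ∧
      (∀ i, i ≠ i₀ → Z (Λ (X i)) = 0) ∧
      (∀ G, Z (Λ G) = r • Λ (pderiv i₀ G)) ∧
      IsWeightedHomogeneous W (Λ.symm g) μ ∧
      pderiv i₀ (Λ.symm g) = 0 ∧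
      (∀ d ∈ (Λ.symm g).support, p ∣ d i₀) := by
  have hp1 : p - 1 + 1 = p := Nat.sub_add_cancel hp.out.one_le
  obtain ⟨Λ, h1, h2, h3, h4, h5, h6⟩ := exists_graded_rectification Z W i₀ r hZ hw h0 hr
    (cast_factorial_pred_ne_zero (k := k) p) (N := p - 1) (fun i => by rw [hp1]; exact hWp i)
  have hD : pderiv i₀ (Λ.symm g) = 0 := (h6 g).mp hZg
  exact ⟨Λ, h1, h2, h3, h4, h5, isWeightedHomogeneous_algEquiv_symm W Λ h2 hg, hD,
    (pderiv_eq_zero_iff_forall_dvd p).mp hD⟩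

/-- **LEMMA D′, free case** (`μ < p·W i₀`, T75's "`G` free of `ε″_{a₀}` when `p·w′ > 1`"): with `g = Λ G`,
`G` is weighted homogeneous of weight `μ`, free of `ε_{i₀}`, and `Z` kills the other new coordinates
(derived here). [cite: VandenessenKurodaCrachiola2021, Ch. 3 §3.2 (Cor. 3.2.10)]
[cite: Hironaka1970AdditiveGroups, additive forms and differential operators] -/
theorem exists_rectifyConstant_notMem_vars (p : ℕ) [Fact p.Prime] [CharP k p]
    (Z : Derivation k (MvPolynomial ι k) (MvPolynomial ι k)) (W : ι → ℕ) (i₀ : ι) (r : k)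
    (hZ : ∀ i, ∀ d ∈ (Z (X i)).support, weight W d + W i₀ = W i) (hw : 0 < W i₀) (h0 : Z (X i₀) = C r)
    (hr : r ≠ 0) (hWp : ∀ i, W i < p * W i₀) {g : MvPolynomial ι k} {μ : ℕ}
    (hg : IsWeightedHomogeneous W g μ) (hZg : Z g = 0) (hμ : μ < p * W i₀) :
    ∃ Λ : MvPolynomial ι k ≃ₐ[k] MvPolynomial ι k,
      Λ (X i₀) = X i₀ ∧
      (∀ i, IsWeightedHomogeneous W (Λ (X i)) (W i)) ∧
      (∀ i, Λ (X i) - X i ∈ Ideal.span ({X i₀} : Set (MvPolynomial ι k))) ∧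
      (∀ i, i ≠ i₀ → Z (Λ (X i)) = 0) ∧
      IsWeightedHomogeneous W (Λ.symm g) μ ∧
      i₀ ∉ (Λ.symm g).vars := by
  obtain ⟨Λ, h1, h2, h3, h4, -, h6, -, h8⟩ :=
    exists_rectifyConstant p Z W i₀ r hZ hw h0 hr hWp hg hZg
  exact ⟨Λ, h1, h2, h3, h4, h6, notMem_vars_of_forall_dvd_of_lt h6 h8 hμ⟩

/-- **LEMMA D′, boundary case** (`μ = p·W i₀`, positive weights; T75's "`G = c′(ε″_{a₀})^p + G₀` when
`w′ = 1/p`"): `G := Λ⁻¹ g = c′·ε_{i₀}^p + G₀` with `G₀` free of `ε_{i₀}` (derived here).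
[cite: VandenessenKurodaCrachiola2021, Ch. 3 §3.2 (Cor. 3.2.10)] [cite: Lang2002, Ch. V §6] -/
theorem exists_rectifyConstant_frobenius (p : ℕ) [Fact p.Prime] [CharP k p]
    (Z : Derivation k (MvPolynomial ι k) (MvPolynomial ι k)) (W : ι → ℕ) (hW : ∀ j, 0 < W j) (i₀ : ι) (r : k)
    (hZ : ∀ i, ∀ d ∈ (Z (X i)).support, weight W d + W i₀ = W i) (h0 : Z (X i₀) = C r)
    (hr : r ≠ 0) (hWp : ∀ i, W i < p * W i₀) {g : MvPolynomial ι k} {μ : ℕ}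
    (hg : IsWeightedHomogeneous W g μ) (hZg : Z g = 0) (hμ : p * W i₀ = μ) :
    ∃ Λ : MvPolynomial ι k ≃ₐ[k] MvPolynomial ι k,
      Λ (X i₀) = X i₀ ∧
      (∀ i, IsWeightedHomogeneous W (Λ (X i)) (W i)) ∧
      (∀ i, Λ (X i) - X i ∈ Ideal.span ({X i₀} : Set (MvPolynomial ι k))) ∧
      (∀ i, i ≠ i₀ → Z (Λ (X i)) = 0) ∧
      IsWeightedHomogeneous W (Λ.symm g) μ ∧
      i₀ ∉ (Λ.symm g - C ((Λ.symm g).coeff (Finsupp.single i₀ p)) * X i₀ ^ p).vars ∧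
      Λ.symm g = C ((Λ.symm g).coeff (Finsupp.single i₀ p)) * X i₀ ^ p
        + (Λ.symm g - C ((Λ.symm g).coeff (Finsupp.single i₀ p)) * X i₀ ^ p) := by
  obtain ⟨Λ, h1, h2, h3, h4, -, h6, h7, -⟩ :=
    exists_rectifyConstant p Z W i₀ r hZ (hW i₀) h0 hr hWp hg hZg
  exact ⟨Λ, h1, h2, h3, h4, h6, eq_C_mul_X_pow_add_of_pderiv_eq_zero p hW h6 h7 hμ⟩

end RectifyConstant

end

end Literature.AlgebraicGeometry.Resolution.WeightedBlowup
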